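/-
Copyright (c) 2026 the pub-hodgecm-mathlib formalisation cell (harness21).  Prover seat hodgecm-mathlib-K2E1-p09 (g5), Track B ∕ K2-LIT,
h413 = `stmt-HodgeConjecture-24833`, line `K2_E1_TraceFormulaBeta`, page «EIS-RANK-ONE», deal [D1] of the dealer K2E1-plan (g3) 2026-09-04T05:34:55Z, (D1-d) with the
REPAIRED level letter (letters alert K2E1-p08 (g5) 06:17:02Z): editions A′ ∕ B′ — the `hdec` plug and `hΛbdd` at `N = 2` over a CM field with `φ` right-invariant under a
FINITE level `{1} × U₀`.  SUPERSEDES the heads of ★ p857767 ∕ ★ p857829, whose level hypotheses («`U` open in `G(𝔸)`» and «`U ≤ K_U`») are jointly unsatisfiable.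
-/
import Summits.HodgeConjecture.HodgeConjecture.Theorems.K2E1EisensteinMinusConstantTermBoundedArchCMTwo   -- ★ p857829 ∕ p857767 (this seat): plumbing §1, `exists_integrable_envelope_line_cm_two`
import Summits.HodgeConjecture.HodgeConjecture.Theorems.K2E1FlatSectionLineLevelU2                     -- ★ (this seat): the finite-level letter (periodicity, fibrewise binder)
import HarnessLib

/-!
# h413 ∕ Track B «K2-LIT», «EIS-RANK-ONE» R6d₂ (D1-d) — `K2E1EisensteinMinusConstantTermBoundedLevelCMTwo`:
# `E(f_z) − E(f_z)_B` bounded in the cusp and `Λ^T E(f_z)` bounded on `U(1,1)(𝔸)` over a CM field — editions A′ (fibrewise binder) and B′ (`hφarch`), FINITE-LEVEL letter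

Cell `pub/hodgecm-mathlib`, crux H413 = `stmt-HodgeConjecture-24833`, route `HCCMUnconditional`; dealer K2E1-plan (g3), deal [D1] 05:34:55Z, ruling «R6d-FIBREWISE» 05:44:38Z;
letters alert K2E1-p08 (g5) 06:17:02Z READ «=».  THEOREMS ONLY (no `def`, no `instance`, no `notation`, no named-fact hypothesis, no `sorry`); lane `--kind proof --supports
stmt-HodgeConjecture-24833 --as helper` (count-neutral).

WHY THIS FILE.  ★ p857767 (`exists_bound_sub_borelConstantTerm_cm_two`, `exists_norm_truncation_flatSectionU_le_cm_two`) and ★ p857829 (`…_of_archSmooth`) ask the level `U` of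
`φ` to be an OPEN subgroup of `G(𝔸) = U(J₂)(𝔸_{L⁺})` contained in `K_U = K_∞·GL₂(𝒪̂_L)`.  That pair is UNSATISFIABLE (an open subgroup of `G(𝔸)` contains the archimedean
component `G_∞`, connected, which `K_U` does not) — those theorems are true and useless.  The level of an automorphic section is a FINITE level `{1} × U₀`, `U₀` a compact OPEN
subgroup of `GL₂(𝔸_L^∞)` (★ `finiteLevelsGL`), which is never open in `G(𝔸)`; the tube lemma only needs the open SET `{v | (adelicVal v)_f ∈ U₀}` and the conjugates
`k⁻¹·n(θ(0,l))·k` have trivial archimedean part — ★ `K2E1FlatSectionLineLevelU2`.  This file restates BOTH editions with the letter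
**`{U₀ : Subgroup (GL (Fin 2) (FiniteAdeleRing (𝓞 L) L))} (hU₀o : IsOpen ↑U₀) (hU₀K : U₀ ≤ glFiniteIntegralLevel 2 L) (hφU : ∀ u, adelicVal u ∈ U₀.map (GLn.ofFinite 2 L) → ∀ y, φ (y·u) = φ y)`**
(satisfiable: principal congruence subgroups of `GL₂(𝒪̂_L)`; `hU₀K` makes `H` invariant under the level, ★ `glIntegralLevel_le_standardMaximalCompactGL`), every other byte and every
proof step as in ★ p857767 ∕ ★ p857829.

* **`exists_bound_sub_borelConstantTerm_level_cm_two`**, **`exists_norm_truncation_flatSectionU_le_level_cm_two`** (edition A′: fibrewise archimedean binder `hA`, `hdecArch`);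
* **`exists_bound_sub_borelConstantTerm_level_cm_two_of_archSmooth`**, **`exists_norm_truncation_flatSectionU_le_level_cm_two_of_archSmooth`** (edition B′: the single binder
  `hφarch` = the dealer's `hφ∞`; [D5] `K2E1KFiniteArchSmoothU2` discharges it for `K_∞`-finite `φ`).

HONEST LABEL.  Count-neutral helper; proves no printed statement; HC_CM is proved only modulo the 7 printed citations (2 remaining named inputs: hLiu418 =
`stmt-HodgeConjecture-24832`, h413 = `stmt-HodgeConjecture-24833`) until rung 0 closes.  The archimedean binder is NOT discharged here.

## References
* [MoeglinWaldspurger1995] C. Mœglin, J.-L. Waldspurger, *Spectral decomposition and Eisenstein series* (1995), I.2.10–I.2.13, II.1.7, IV.2.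
* [Garrett2018] P. Garrett, *Modern Analysis of Automorphic Forms by Example* 1 (2018), §2.8–§2.11.
* [BorelJacquet1979] A. Borel, H. Jacquet, *Automorphic forms and automorphic representations* (1979), §4.1.
-/

set_option autoImplicit false
set_option linter.dupNamespace false  -- the mandated namespace repeats the summit's segment (`HodgeConjecture.HodgeConjecture`)

noncomputable section

open MeasureTheory Measure Filter Topology NumberField IsDedekindDomain MulAction Module
open Literature.NumberTheory.Automorphic Literature.NumberTheory.Automorphic.UnitaryGroup Literature.NumberTheory.GaloisRepresentations
open Summit.HodgeConjecture.HodgeConjecture.Cruxes.H413.K2E1BorelEisensteinU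
open Summit.HodgeConjecture.HodgeConjecture.Cruxes.H413.K2E1EisensteinMinusConstantTermCuspBoundU2
open Summit.HodgeConjecture.HodgeConjecture.Cruxes.H413.K2E1FlatSectionLineRestrictionU2
open Summit.HodgeConjecture.HodgeConjecture.Cruxes.H413.K2E1UnipotentHaarNormalisationU2
open Summit.HodgeConjecture.HodgeConjecture.Cruxes.H413.K2E1AdelicFourierEnvelope
open Summit.HodgeConjecture.HodgeConjecture.Cruxes.H413.K2E1AdelicFourierDecay
open Summit.HodgeConjecture.HodgeConjecture.Cruxes.H413.K2E1EisensteinAnalyticBinders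
open Summit.HodgeConjecture.HodgeConjecture.Cruxes.H413.K2E1BorelEisensteinGodementCMTwo
open Summit.HodgeConjecture.HodgeConjecture.Cruxes.H413.K2E1TruncatedEisensteinBoundedCMTwo
open Summit.HodgeConjecture.HodgeConjecture.Cruxes.H413.K2E1EisensteinMinusConstantTermBoundedCMTwo
open Summit.HodgeConjecture.HodgeConjecture.Cruxes.H413.K2E1EisensteinMinusConstantTermBoundedArchCMTwo
open Summit.HodgeConjecture.HodgeConjecture.Cruxes.H413.K2E1FlatSectionLineLevelU2
open NumberField.mixedEmbedding
-- `Classical` is needed to see the Mathlib normed-space instances on `mixedSpace` (note H5 of `AdelicGLnGlue`)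
open scoped ENNReal NNReal Classical

namespace Summit.HodgeConjecture.HodgeConjecture.Cruxes.H413.K2E1EisensteinMinusConstantTermBoundedLevelCMTwo

variable (L : Type) [Field L] [NumberField L] [IsCMField L]
  (hij : (((0 : Fin 2) : ℕ)) + 1 = ((1 : Fin 2) : ℕ)) (hN : 2 = 2 * ((0 : Fin 2) : ℕ) + 2)
  [MeasurableSpace (quasiSplit (↥(maximalRealSubfield L)) L (IsCMField.complexConj L) 2).Adelic] [BorelSpace (quasiSplit (↥(maximalRealSubfield L)) L (IsCMField.complexConj L) 2).Adelic]
  [MeasurableSpace (AdeleRing (𝓞 L) L)] [BorelSpace (AdeleRing (𝓞 L) L)]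
  [MeasurableSpace (AdeleRing (𝓞 ↥(maximalRealSubfield L)) ↥(maximalRealSubfield L))] [BorelSpace (AdeleRing (𝓞 ↥(maximalRealSubfield L)) ↥(maximalRealSubfield L))]
  [MeasurableSpace (InfiniteAdeleRing ↥(maximalRealSubfield L))] [BorelSpace (InfiniteAdeleRing ↥(maximalRealSubfield L))]
  [MeasurableSpace (FiniteAdeleRing (𝓞 ↥(maximalRealSubfield L)) ↥(maximalRealSubfield L))] [BorelSpace (FiniteAdeleRing (𝓞 ↥(maximalRealSubfield L)) ↥(maximalRealSubfield L))]

/-! ## Edition A′: the fibrewise archimedean binder, finite-level letter -/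

/-- **(D1-d), EDITION A′ — `E(f_z) − E(f_z)_B` IS BOUNDED IN THE CUSP OF `U(1,1)` OVER A CM FIELD**, `φ` right-invariant under the FINITE level `{1} × U₀` (`U₀ ≤ GL₂(𝒪̂_L)` open).
Inputs as in ★ p857767 with the repaired level letter; the only non-★ input is the fibrewise archimedean Fourier decay of the big-cell sections (`hA`, `hdecArch`).
[cite: MoeglinWaldspurger1995, I.2.10–I.2.12, II.1.7] [cite: Garrett2018, §2.9] -/
theorem exists_bound_sub_borelConstantTerm_level_cm_two {δ : L} (hcδ : IsCMField.complexConj L δ = -δ) (hδ : δ ≠ 0)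
    (ν : Measure ↥(adelicUnipotent ↥(maximalRealSubfield L) L (IsCMField.complexConj L) 2)) [ν.IsHaarMeasure]
    {𝓕 : Set ↥(adelicUnipotent ↥(maximalRealSubfield L) L (IsCMField.complexConj L) 2)} (h𝓕 : IsFundamentalDomain ↥(rationalUnipotent ↥(maximalRealSubfield L) L (IsCMField.complexConj L) 2) 𝓕 ν)
    (h𝓕c : IsCompact (closure 𝓕))
    (μ : Measure (AdeleRing (𝓞 ↥(maximalRealSubfield L)) ↥(maximalRealSubfield L))) [μ.IsAddHaarMeasure]
    (μ₁ : Measure (InfiniteAdeleRing ↥(maximalRealSubfield L))) [μ₁.IsAddHaarMeasure] (μ₂ : Measure (FiniteAdeleRing (𝓞 ↥(maximalRealSubfield L)) ↥(maximalRealSubfield L))) [μ₂.IsAddHaarMeasure]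
    (χ : HeckeCharacter L) (hχ : χ.IsUnitary) {z : ℂ} (hz : 1 < z.re)
    {φ : (quasiSplit (↥(maximalRealSubfield L)) L (IsCMField.complexConj L) 2).Adelic → ℂ} (hφc : Continuous φ) {Mφ : ℝ} (hφM : ∀ x, ‖φ x‖ ≤ Mφ)
    (hφB : ∀ b ∈ borelU ((IsCMField.complexConj L : L ≃ₐ[↥(maximalRealSubfield L)] L) : L →+* L) ((StdForm.antidiagonal 2).over L), ∀ x : (quasiSplit (↥(maximalRealSubfield L)) L (IsCMField.complexConj L) 2).Adelic, φ ((quasiSplit (↥(maximalRealSubfield L)) L (IsCMField.complexConj L) 2).toAdelic b * x) = φ x)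
    (hf : ∀ (b g : (quasiSplit (↥(maximalRealSubfield L)) L (IsCMField.complexConj L) 2).Adelic) (u : (AdeleRing (𝓞 L) L)ˣ),
      ((b.1 : GL (Fin 2) (AdeleRing (𝓞 L) L)) : Matrix (Fin 2) (Fin 2) (AdeleRing (𝓞 L) L)) 1 0 = 0 →
      (u : (AdeleRing (𝓞 L) L)) = ((b.1 : GL (Fin 2) (AdeleRing (𝓞 L) L)) : Matrix (Fin 2) (Fin 2) (AdeleRing (𝓞 L) L)) 0 0 →
        flatSectionU φ z (b * g) = ((χ u : ℂˣ) : ℂ) * ((ideleNorm u : ℝ) : ℂ) ^ z * flatSectionU φ z g)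
    {U₀ : Subgroup (GL (Fin 2) (FiniteAdeleRing (𝓞 L) L))} (hU₀o : IsOpen (U₀ : Set (GL (Fin 2) (FiniteAdeleRing (𝓞 L) L))))
    (hU₀K : U₀ ≤ glFiniteIntegralLevel 2 L)
    (hφU : ∀ u : (quasiSplit (↥(maximalRealSubfield L)) L (IsCMField.complexConj L) 2).Adelic, adelicVal ↥(maximalRealSubfield L) L (IsCMField.complexConj L) 2 ((StdForm.antidiagonal 2).over L) u ∈ U₀.map (GLn.ofFinite 2 L) → ∀ y : (quasiSplit (↥(maximalRealSubfield L)) L (IsCMField.complexConj L) 2).Adelic, φ (y * u) = φ y)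
    {T : ℝ≥0} (hT : 1 ≤ T) {m : ℕ} (hm : (finrank ℚ ↥(maximalRealSubfield L) : ℝ) < m)
    -- the fibrewise archimedean binder (★ p857712's (iii″) for the big-cell sections along the line, uniformly on `K_U`)
    {A : (quasiSplit (↥(maximalRealSubfield L)) L (IsCMField.complexConj L) 2).Adelic → FiniteAdeleRing (𝓞 ↥(maximalRealSubfield L)) ↥(maximalRealSubfield L) → ℝ} {N₂ : ℝ} (hN₂ : 0 ≤ N₂)
    (hA : ∀ k ∈ ((standardMaximalCompactGL 2 L).comap (adelicVal ↥(maximalRealSubfield L) L (IsCMField.complexConj L) 2 ((StdForm.antidiagonal 2).over L)) : Subgroup (quasiSplit (↥(maximalRealSubfield L)) L (IsCMField.complexConj L) 2).Adelic), Integrable (A k) μ₂ ∧ ∫ b, A k b ∂μ₂ ≤ N₂)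
    (hdecArch : ∀ k ∈ ((standardMaximalCompactGL 2 L).comap (adelicVal ↥(maximalRealSubfield L) L (IsCMField.complexConj L) 2 ((StdForm.antidiagonal 2).over L)) : Subgroup (quasiSplit (↥(maximalRealSubfield L)) L (IsCMField.complexConj L) 2).Adelic), ∀ (b : FiniteAdeleRing (𝓞 ↥(maximalRealSubfield L)) ↥(maximalRealSubfield L)) (y : InfiniteAdeleRing ↥(maximalRealSubfield L)),
      ‖∫ a, flatSectionU φ z (((quasiSplit (↥(maximalRealSubfield L)) L (IsCMField.complexConj L) 2).toAdelic (weylLongU ((IsCMField.complexConj L : L ≃ₐ[↥(maximalRealSubfield L)] L) : L →+* L) (rfl : ((StdForm.antidiagonal 2).over L) = ((StdForm.antidiagonal 2).over L)))) *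
          ((middleRootUnipotent hij hN (Multiplicative.ofAdd (traceZeroLine ↥(maximalRealSubfield L) L (IsCMField.complexConj L) hcδ hδ ((a, b) : AdeleRing (𝓞 ↥(maximalRealSubfield L)) ↥(maximalRealSubfield L)))) : ↥(adelicUnipotent ↥(maximalRealSubfield L) L (IsCMField.complexConj L) 2)) : (quasiSplit (↥(maximalRealSubfield L)) L (IsCMField.complexConj L) 2).Adelic) * k) *
        (adeleAddChar ↥(maximalRealSubfield L) (infiniteAdeleInl ↥(maximalRealSubfield L) (y * a)) : ℂ) ∂μ₁‖ ≤ A k b * (1 + ‖InfiniteAdeleRing.ringEquiv_mixedSpace ↥(maximalRealSubfield L) y‖) ^ (-(m : ℝ))) :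
    ∃ M₁ : ℝ, ∀ g : (quasiSplit (↥(maximalRealSubfield L)) L (IsCMField.complexConj L) 2).Adelic, T < borelHeight g →
      ‖eisensteinSeriesU (flatSectionU φ z) g - borelConstantTerm ν 𝓕 (eisensteinSeriesU (flatSectionU φ z)) g‖ ≤ M₁ := by
  classical
  -- the CM pair
  haveI : Algebra.IsQuadraticExtension ↥(maximalRealSubfield L) L := IsCMField.isQuadraticExtension L
  haveI : LocallyCompactSpace (AdeleRing (𝓞 L) L) := locallyCompactSpace_adeleRing' L
  have hc : (IsCMField.complexConj L) * (IsCMField.complexConj L) = 1 := AlgEquiv.ext fun x => IsCMField.complexConj_apply_apply L x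
  -- letters: `f_z = flatSectionU φ z`
  have hfc : Continuous (flatSectionU φ z) := continuous_flatSectionU hφc z
  have hfm : Measurable (flatSectionU φ z) := hfc.measurable
  have hfB := flatSectionU_toAdelic_mul hφB z
  have hfN : ∀ (n : ↥(adelicUnipotent ↥(maximalRealSubfield L) L (IsCMField.complexConj L) 2)) (y : (quasiSplit (↥(maximalRealSubfield L)) L (IsCMField.complexConj L) 2).Adelic),
      flatSectionU φ z ((n : (quasiSplit (↥(maximalRealSubfield L)) L (IsCMField.complexConj L) 2).Adelic) * y) = flatSectionU φ z y :=
    unipotent_mul_of_borelLaw χ z hf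
  have hfU : ∀ u : (quasiSplit (↥(maximalRealSubfield L)) L (IsCMField.complexConj L) 2).Adelic, adelicVal ↥(maximalRealSubfield L) L (IsCMField.complexConj L) 2 ((StdForm.antidiagonal 2).over L) u ∈ U₀.map (GLn.ofFinite 2 L) →
      ∀ y : (quasiSplit (↥(maximalRealSubfield L)) L (IsCMField.complexConj L) 2).Adelic, flatSectionU φ z (y * u) = flatSectionU φ z y := by
    intro u hu y
    obtain ⟨w, hw, hwu⟩ := Subgroup.mem_map.1 hu
    have hk : u ∈ ((standardMaximalCompactGL 2 L).comap (adelicVal ↥(maximalRealSubfield L) L (IsCMField.complexConj L) 2 ((StdForm.antidiagonal 2).over L)) : Subgroup (quasiSplit (↥(maximalRealSubfield L)) L (IsCMField.complexConj L) 2).Adelic) :=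
      Subgroup.mem_comap.2 (by rw [← hwu]; exact glIntegralLevel_le_standardMaximalCompactGL (GLn.ofFinite_mem_glIntegralLevel (hU₀K hw)))
    rw [flatSectionU_apply, flatSectionU_apply, hφU u hu y, borelHeight_mul_of_mem_comap_standardMaximalCompactGL hk y]
  -- the compact `K_U`, Iwasawa, heights on `K_U`
  have hKc : IsCompact (((standardMaximalCompactGL 2 L).comap (adelicVal ↥(maximalRealSubfield L) L (IsCMField.complexConj L) 2 ((StdForm.antidiagonal 2).over L)) : Subgroup (quasiSplit (↥(maximalRealSubfield L)) L (IsCMField.complexConj L) 2).Adelic) : Set (quasiSplit (↥(maximalRealSubfield L)) L (IsCMField.complexConj L) 2).Adelic) := isCompact_comap_adelicVal_standardMaximalCompactGL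
  have hIw' : ∀ g : (quasiSplit (↥(maximalRealSubfield L)) L (IsCMField.complexConj L) 2).Adelic, ∃ b ∈ borelAdelic ↥(maximalRealSubfield L) L (IsCMField.complexConj L) 2, ∃ k ∈ (((standardMaximalCompactGL 2 L).comap (adelicVal ↥(maximalRealSubfield L) L (IsCMField.complexConj L) 2 ((StdForm.antidiagonal 2).over L)) : Subgroup (quasiSplit (↥(maximalRealSubfield L)) L (IsCMField.complexConj L) 2).Adelic) : Set (quasiSplit (↥(maximalRealSubfield L)) L (IsCMField.complexConj L) 2).Adelic), g = b * k := fun g => by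
    obtain ⟨b, hb, k, hk, hg⟩ := exists_mem_borelAdelic_mul_mem_standardMaximalCompactGL_cm L g
    exact ⟨b, hb, k, Subgroup.mem_comap.2 hk, hg⟩
  have hIw := exists_chart_torus_of_borel_mul hij hN hcδ hδ hIw'
  have hK : ∀ k ∈ (((standardMaximalCompactGL 2 L).comap (adelicVal ↥(maximalRealSubfield L) L (IsCMField.complexConj L) 2 ((StdForm.antidiagonal 2).over L)) : Subgroup (quasiSplit (↥(maximalRealSubfield L)) L (IsCMField.complexConj L) 2).Adelic) : Set (quasiSplit (↥(maximalRealSubfield L)) L (IsCMField.complexConj L) 2).Adelic), (borelHeight k : ℝ) ≤ (T : ℝ) := fun k hk => by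
    rw [borelHeight_eq_one_of_mem_maximalCompact hk, NNReal.coe_one]; exact_mod_cast hT
  -- the fundamental domain
  haveI := locallyCompactSpace_traceZeroAdele (F := ↥(maximalRealSubfield L)) (E := L) (c := (IsCMField.complexConj L))
  obtain ⟨h𝓕₀, h𝓕top⟩ := measure_fundamentalDomain_ne_zero_and_lt_top_two hij hN hc (Measure.addHaar : Measure ↥(traceZeroAdele ↥(maximalRealSubfield L) L (IsCMField.complexConj L))) ν h𝓕
  -- Godement at the CM pair: the locally uniform majorant of the left Eisenstein terms of `f`
  have hmaj := fun y₀ : (quasiSplit (↥(maximalRealSubfield L)) L (IsCMField.complexConj L) 2).Adelic => exists_locallyUniform_majorant_flatSectionU_cm_two L hz hφM y₀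
  have hcont : ∀ q : Quotient (orbitRel ↥(borelU ((IsCMField.complexConj L : L ≃ₐ[↥(maximalRealSubfield L)] L) : L →+* L) ((StdForm.antidiagonal 2).over L)) ↥(unitaryGroupOfForm ((IsCMField.complexConj L : L ≃ₐ[↥(maximalRealSubfield L)] L) : L →+* L) ((StdForm.antidiagonal 2).over L))),
      Continuous fun y : (quasiSplit (↥(maximalRealSubfield L)) L (IsCMField.complexConj L) 2).Adelic => flatSectionU φ z ((quasiSplit (↥(maximalRealSubfield L)) L (IsCMField.complexConj L) 2).toAdelic (q.out : ↥(unitaryGroupOfForm ((IsCMField.complexConj L : L ≃ₐ[↥(maximalRealSubfield L)] L) : L →+* L) ((StdForm.antidiagonal 2).over L))) * y) :=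
    fun q => hfc.comp (continuous_const.mul continuous_id)
  have hfin := fun g : (quasiSplit (↥(maximalRealSubfield L)) L (IsCMField.complexConj L) 2).Adelic => hfin_of_locallyUniformMajorant ν hfB hcont hmaj h𝓕c g
  have hs := fun g : (quasiSplit (↥(maximalRealSubfield L)) L (IsCMField.complexConj L) 2).Adelic => (summable_eisensteinSeriesU_flatSectionU_cm_two L hz hφM g).of_norm
  -- the Poisson binders along the line (★ (D1-c) I) and the normalisation (★ (D1-a))
  have hΦc := fun g : (quasiSplit (↥(maximalRealSubfield L)) L (IsCMField.complexConj L) 2).Adelic => continuous_weylLong_mul_line_mul hij hN hcδ hδ hfc g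
  have hΦi := fun g : (quasiSplit (↥(maximalRealSubfield L)) L (IsCMField.complexConj L) 2).Adelic => integrable_weylLong_mul_line_mul_two hij hN hcδ hδ μ ν hfm hfN hfB h𝓕 g (hfin g)
  have hloc := fun (g : (quasiSplit (↥(maximalRealSubfield L)) L (IsCMField.complexConj L) 2).Adelic) (C₀ : Set (AdeleRing (𝓞 ↥(maximalRealSubfield L)) ↥(maximalRealSubfield L))) (hC₀ : IsCompact C₀) =>
    exists_summable_majorant_line_translate_two hij hN hcδ hδ hfB hmaj hC₀ g
  have hnorm := forall_inv_measure_smul_integral_weylLong_eq_two hij hN hcδ hδ hc μ ν h𝓕 (flatSectionU φ z)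
  -- ONE level `𝔫` for all of `K_U` (★ (D1-c) I), then the envelope constants (★ p857712) and the decay constant (★ p857643)
  obtain ⟨𝔫, h𝔫, hper⟩ := exists_levelIdeal_forall_line_periodic_of_level_two' hij hN hcδ hδ hKc hU₀o hfU
  obtain ⟨cE, hcE, Cf, hCfc, henv⟩ := exists_envelope ↥(maximalRealSubfield L) μ μ₁ μ₂ h𝔫
  have hM0 : 0 ≤ cE * N₂ := mul_nonneg hcE.le hN₂
  have hmm : (m : ℝ) ≤ ((m : ℕ) : ℝ) := le_rfl
  obtain ⟨C, hC0, hdecay⟩ := exists_forall_tsum_indicator_norm_mul_le_rpow_neg ↥(maximalRealSubfield L) hM0 hCfc hm hmm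
  -- the archimedean binder ⟹ the decay class, for every `k ∈ K_U`
  have hd : 0 < (finrank ℚ ↥(maximalRealSubfield L) : ℝ) := Nat.cast_pos.2 finrank_pos
  have hσβ : 1 ≤ z.re + (m : ℝ) / (finrank ℚ ↥(maximalRealSubfield L) : ℝ) := le_add_of_le_of_nonneg hz.le (div_nonneg (Nat.cast_nonneg m) hd.le)
  have hdec : ∀ k ∈ (((standardMaximalCompactGL 2 L).comap (adelicVal ↥(maximalRealSubfield L) L (IsCMField.complexConj L) 2 ((StdForm.antidiagonal 2).over L)) : Subgroup (quasiSplit (↥(maximalRealSubfield L)) L (IsCMField.complexConj L) 2).Adelic) : Set (quasiSplit (↥(maximalRealSubfield L)) L (IsCMField.complexConj L) 2).Adelic), ∀ Λ' : (AdeleRing (𝓞 ↥(maximalRealSubfield L)) ↥(maximalRealSubfield L))ˣ, 1 ≤ ((IdeleClassGroup.ideleNorm ↥(maximalRealSubfield L) Λ' : ℝ≥0) : ℝ) →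
      (Summable fun ξ : ↥(maximalRealSubfield L) => ‖∫ v, (fun x : AdeleRing (𝓞 ↥(maximalRealSubfield L)) ↥(maximalRealSubfield L) => flatSectionU φ z (((quasiSplit (↥(maximalRealSubfield L)) L (IsCMField.complexConj L) 2).toAdelic (weylLongU ((IsCMField.complexConj L : L ≃ₐ[↥(maximalRealSubfield L)] L) : L →+* L) (rfl : ((StdForm.antidiagonal 2).over L) = ((StdForm.antidiagonal 2).over L)))) *
          ((middleRootUnipotent hij hN (Multiplicative.ofAdd (traceZeroLine ↥(maximalRealSubfield L) L (IsCMField.complexConj L) hcδ hδ x)) : ↥(adelicUnipotent ↥(maximalRealSubfield L) L (IsCMField.complexConj L) 2)) : (quasiSplit (↥(maximalRealSubfield L)) L (IsCMField.complexConj L) 2).Adelic) * k)) v *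
        (adeleAddChar ↥(maximalRealSubfield L) (algebraMap ↥(maximalRealSubfield L) (AdeleRing (𝓞 ↥(maximalRealSubfield L)) ↥(maximalRealSubfield L)) ξ * (Λ' : AdeleRing (𝓞 ↥(maximalRealSubfield L)) ↥(maximalRealSubfield L)) * v) : ℂ) ∂μ‖) ∧
      ∑' ξ : ↥(maximalRealSubfield L), ({0}ᶜ : Set ↥(maximalRealSubfield L)).indicator (fun ξ => ‖∫ v, (fun x : AdeleRing (𝓞 ↥(maximalRealSubfield L)) ↥(maximalRealSubfield L) => flatSectionU φ z (((quasiSplit (↥(maximalRealSubfield L)) L (IsCMField.complexConj L) 2).toAdelic (weylLongU ((IsCMField.complexConj L : L ≃ₐ[↥(maximalRealSubfield L)] L) : L →+* L) (rfl : ((StdForm.antidiagonal 2).over L) = ((StdForm.antidiagonal 2).over L)))) *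
          ((middleRootUnipotent hij hN (Multiplicative.ofAdd (traceZeroLine ↥(maximalRealSubfield L) L (IsCMField.complexConj L) hcδ hδ x)) : ↥(adelicUnipotent ↥(maximalRealSubfield L) L (IsCMField.complexConj L) 2)) : (quasiSplit (↥(maximalRealSubfield L)) L (IsCMField.complexConj L) 2).Adelic) * k)) v *
        (adeleAddChar ↥(maximalRealSubfield L) (algebraMap ↥(maximalRealSubfield L) (AdeleRing (𝓞 ↥(maximalRealSubfield L)) ↥(maximalRealSubfield L)) ξ * (Λ' : AdeleRing (𝓞 ↥(maximalRealSubfield L)) ↥(maximalRealSubfield L)) * v) : ℂ) ∂μ‖) ξ ≤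
        C * ((IdeleClassGroup.ideleNorm ↥(maximalRealSubfield L) Λ' : ℝ≥0) : ℝ) ^ (-((m : ℝ) / (finrank ℚ ↥(maximalRealSubfield L) : ℝ))) := by
    intro k hk Λ' _
    set Φ : AdeleRing (𝓞 ↥(maximalRealSubfield L)) ↥(maximalRealSubfield L) → ℂ := fun x => flatSectionU φ z (((quasiSplit (↥(maximalRealSubfield L)) L (IsCMField.complexConj L) 2).toAdelic (weylLongU ((IsCMField.complexConj L : L ≃ₐ[↥(maximalRealSubfield L)] L) : L →+* L) (rfl : ((StdForm.antidiagonal 2).over L) = ((StdForm.antidiagonal 2).over L)))) *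
      ((middleRootUnipotent hij hN (Multiplicative.ofAdd (traceZeroLine ↥(maximalRealSubfield L) L (IsCMField.complexConj L) hcδ hδ x)) : ↥(adelicUnipotent ↥(maximalRealSubfield L) L (IsCMField.complexConj L) 2)) : (quasiSplit (↥(maximalRealSubfield L)) L (IsCMField.complexConj L) 2).Adelic) * k) with hΦ
    have hΦprod : Integrable (fun p : InfiniteAdeleRing ↥(maximalRealSubfield L) × FiniteAdeleRing (𝓞 ↥(maximalRealSubfield L)) ↥(maximalRealSubfield L) => Φ (p.1, p.2)) (μ₁.prod μ₂) :=
      (integrable_iff_integrable_prod ↥(maximalRealSubfield L) μ μ₁ μ₂ Φ).1 (hΦi k)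
    obtain ⟨hAk, hAN⟩ := hA k hk
    obtain ⟨hMΨ, hCfΨ⟩ := henv Φ (A k) N₂ m hΦprod (fun a b l hl => hper k hk a b l hl) (fun b y => hdecArch k hk b y) hAk hAN
    exact hdecay (fun η => ∫ v, Φ v * (adeleAddChar ↥(maximalRealSubfield L) (η * v) : ℂ) ∂μ) hMΨ hCfΨ Λ'
  -- the cusp bound ★ p857628
  haveI := isInvInvariant_of_isHaarMeasure_two (F := ↥(maximalRealSubfield L)) (E := L) (c := IsCMField.complexConj L) ν
  refine ⟨(μ (adeleFundamentalDomain ↥(maximalRealSubfield L))).toReal⁻¹ * C, fun g hg => ?_⟩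
  have hg' : (T : ℝ) < (borelHeight g : ℝ) := by exact_mod_cast hg
  exact forall_norm_sub_borelConstantTerm_le_two hij hN hcδ hδ ν χ hχ z hfm hfN hfB hf h𝓕 h𝓕₀ h𝓕top.ne μ hC0 hσβ hK hIw
    hfin hs hΦc hΦi hloc hnorm hdec g hg'

/-- **`Λ^T E(f_z)` IS BOUNDED ON `U(J₂)(𝔸)` OVER A CM FIELD, modulo the fibrewise archimedean binder** — the 1-call composition of the head with ★ p857723
`exists_norm_truncation_eisensteinSeriesU_flatSectionU_le_cm_two` (`hcov`, `hlow` discharged there): `∃ M, ∀ g, ‖Λ^T E(f_z)(g)‖ ≤ M` = FILE 2's `hΛbdd` at `N = 2`.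
[cite: MoeglinWaldspurger1995, I.2.13, IV.2] [cite: Garrett2018, §2.10–§2.11] -/
theorem exists_norm_truncation_flatSectionU_le_level_cm_two {δ : L} (hcδ : IsCMField.complexConj L δ = -δ) (hδ : δ ≠ 0)
    (ν : Measure ↥(adelicUnipotent ↥(maximalRealSubfield L) L (IsCMField.complexConj L) 2)) [ν.IsHaarMeasure]
    {𝓕 : Set ↥(adelicUnipotent ↥(maximalRealSubfield L) L (IsCMField.complexConj L) 2)} (h𝓕 : IsFundamentalDomain ↥(rationalUnipotent ↥(maximalRealSubfield L) L (IsCMField.complexConj L) 2) 𝓕 ν)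
    (h𝓕c : IsCompact (closure 𝓕))
    (μ : Measure (AdeleRing (𝓞 ↥(maximalRealSubfield L)) ↥(maximalRealSubfield L))) [μ.IsAddHaarMeasure]
    (μ₁ : Measure (InfiniteAdeleRing ↥(maximalRealSubfield L))) [μ₁.IsAddHaarMeasure] (μ₂ : Measure (FiniteAdeleRing (𝓞 ↥(maximalRealSubfield L)) ↥(maximalRealSubfield L))) [μ₂.IsAddHaarMeasure]
    (χ : HeckeCharacter L) (hχ : χ.IsUnitary) {z : ℂ} (hz : 1 < z.re)
    {φ : (quasiSplit (↥(maximalRealSubfield L)) L (IsCMField.complexConj L) 2).Adelic → ℂ} (hφc : Continuous φ) {Mφ : ℝ} (hφM : ∀ x, ‖φ x‖ ≤ Mφ)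
    (hφB : ∀ b ∈ borelU ((IsCMField.complexConj L : L ≃ₐ[↥(maximalRealSubfield L)] L) : L →+* L) ((StdForm.antidiagonal 2).over L), ∀ x : (quasiSplit (↥(maximalRealSubfield L)) L (IsCMField.complexConj L) 2).Adelic, φ ((quasiSplit (↥(maximalRealSubfield L)) L (IsCMField.complexConj L) 2).toAdelic b * x) = φ x)
    (hf : ∀ (b g : (quasiSplit (↥(maximalRealSubfield L)) L (IsCMField.complexConj L) 2).Adelic) (u : (AdeleRing (𝓞 L) L)ˣ),
      ((b.1 : GL (Fin 2) (AdeleRing (𝓞 L) L)) : Matrix (Fin 2) (Fin 2) (AdeleRing (𝓞 L) L)) 1 0 = 0 →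
      (u : (AdeleRing (𝓞 L) L)) = ((b.1 : GL (Fin 2) (AdeleRing (𝓞 L) L)) : Matrix (Fin 2) (Fin 2) (AdeleRing (𝓞 L) L)) 0 0 →
        flatSectionU φ z (b * g) = ((χ u : ℂˣ) : ℂ) * ((ideleNorm u : ℝ) : ℂ) ^ z * flatSectionU φ z g)
    {U₀ : Subgroup (GL (Fin 2) (FiniteAdeleRing (𝓞 L) L))} (hU₀o : IsOpen (U₀ : Set (GL (Fin 2) (FiniteAdeleRing (𝓞 L) L))))
    (hU₀K : U₀ ≤ glFiniteIntegralLevel 2 L)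
    (hφU : ∀ u : (quasiSplit (↥(maximalRealSubfield L)) L (IsCMField.complexConj L) 2).Adelic, adelicVal ↥(maximalRealSubfield L) L (IsCMField.complexConj L) 2 ((StdForm.antidiagonal 2).over L) u ∈ U₀.map (GLn.ofFinite 2 L) → ∀ y : (quasiSplit (↥(maximalRealSubfield L)) L (IsCMField.complexConj L) 2).Adelic, φ (y * u) = φ y)
    {T : ℝ≥0} (hT : 1 ≤ T) {m : ℕ} (hm : (finrank ℚ ↥(maximalRealSubfield L) : ℝ) < m)
    {A : (quasiSplit (↥(maximalRealSubfield L)) L (IsCMField.complexConj L) 2).Adelic → FiniteAdeleRing (𝓞 ↥(maximalRealSubfield L)) ↥(maximalRealSubfield L) → ℝ} {N₂ : ℝ} (hN₂ : 0 ≤ N₂)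
    (hA : ∀ k ∈ ((standardMaximalCompactGL 2 L).comap (adelicVal ↥(maximalRealSubfield L) L (IsCMField.complexConj L) 2 ((StdForm.antidiagonal 2).over L)) : Subgroup (quasiSplit (↥(maximalRealSubfield L)) L (IsCMField.complexConj L) 2).Adelic), Integrable (A k) μ₂ ∧ ∫ b, A k b ∂μ₂ ≤ N₂)
    (hdecArch : ∀ k ∈ ((standardMaximalCompactGL 2 L).comap (adelicVal ↥(maximalRealSubfield L) L (IsCMField.complexConj L) 2 ((StdForm.antidiagonal 2).over L)) : Subgroup (quasiSplit (↥(maximalRealSubfield L)) L (IsCMField.complexConj L) 2).Adelic), ∀ (b : FiniteAdeleRing (𝓞 ↥(maximalRealSubfield L)) ↥(maximalRealSubfield L)) (y : InfiniteAdeleRing ↥(maximalRealSubfield L)),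
      ‖∫ a, flatSectionU φ z (((quasiSplit (↥(maximalRealSubfield L)) L (IsCMField.complexConj L) 2).toAdelic (weylLongU ((IsCMField.complexConj L : L ≃ₐ[↥(maximalRealSubfield L)] L) : L →+* L) (rfl : ((StdForm.antidiagonal 2).over L) = ((StdForm.antidiagonal 2).over L)))) *
          ((middleRootUnipotent hij hN (Multiplicative.ofAdd (traceZeroLine ↥(maximalRealSubfield L) L (IsCMField.complexConj L) hcδ hδ ((a, b) : AdeleRing (𝓞 ↥(maximalRealSubfield L)) ↥(maximalRealSubfield L)))) : ↥(adelicUnipotent ↥(maximalRealSubfield L) L (IsCMField.complexConj L) 2)) : (quasiSplit (↥(maximalRealSubfield L)) L (IsCMField.complexConj L) 2).Adelic) * k) *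
        (adeleAddChar ↥(maximalRealSubfield L) (infiniteAdeleInl ↥(maximalRealSubfield L) (y * a)) : ℂ) ∂μ₁‖ ≤ A k b * (1 + ‖InfiniteAdeleRing.ringEquiv_mixedSpace ↥(maximalRealSubfield L) y‖) ^ (-(m : ℝ))) :
    ∃ M : ℝ, ∀ g : (quasiSplit (↥(maximalRealSubfield L)) L (IsCMField.complexConj L) 2).Adelic, ‖truncation ν 𝓕 T (eisensteinSeriesU (flatSectionU φ z)) g‖ ≤ M := by
  obtain ⟨M₁, hdec⟩ := exists_bound_sub_borelConstantTerm_level_cm_two L hij hN hcδ hδ ν h𝓕 h𝓕c μ μ₁ μ₂ χ hχ hz hφc hφM hφB hf hU₀o hU₀K hφU hT hm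
    hN₂ hA hdecArch
  obtain ⟨M₀, h⟩ := exists_norm_truncation_eisensteinSeriesU_flatSectionU_le_cm_two L ν h𝓕 hT hz hφc hφM hφB hdec
  exact ⟨max M₀ M₁, h⟩


/-! ## Edition B′: the single archimedean smoothness binder `hφarch`, finite-level letter -/

/-- **(D1-d), EDITION B — `E(f_z) − E(f_z)_B` IS BOUNDED IN THE CUSP OF `U(1,1)` OVER A CM FIELD, from the single archimedean smoothness binder `hφarch`** (ruling «R6d-FIBREWISE» (2)):
for every `k ∈ K_U` and `b ∈ 𝔸_{L⁺}^∞` the function `s ↦ f_z(ι(w₀)·n(θ(ι⁻¹ s, b))·k)` on `L⁺ ⊗ ℝ` is `C^m` (`m > [L⁺:ℚ]`) with `‖D^j‖ ≤ C_φ·H(ι(w₀)·n(θ(ι⁻¹ s, b))·k)^{Re z}` (`j ≤ m`).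
Edition A (★ §2) ∘ ★ p857800 `exists_fibre_majorant_of_archSmooth` with the envelope of `exists_integrable_envelope_line_cm_two`. [cite: MoeglinWaldspurger1995, I.2.10–I.2.12, II.1.7] [cite: Garrett2018, §2.9] -/
theorem exists_bound_sub_borelConstantTerm_level_cm_two_of_archSmooth {δ : L} (hcδ : IsCMField.complexConj L δ = -δ) (hδ : δ ≠ 0)
    (ν : Measure ↥(adelicUnipotent ↥(maximalRealSubfield L) L (IsCMField.complexConj L) 2)) [ν.IsHaarMeasure]
    {𝓕 : Set ↥(adelicUnipotent ↥(maximalRealSubfield L) L (IsCMField.complexConj L) 2)} (h𝓕 : IsFundamentalDomain ↥(rationalUnipotent ↥(maximalRealSubfield L) L (IsCMField.complexConj L) 2) 𝓕 ν)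
    (h𝓕c : IsCompact (closure 𝓕))
    (μ : Measure (AdeleRing (𝓞 ↥(maximalRealSubfield L)) ↥(maximalRealSubfield L))) [μ.IsAddHaarMeasure]
    (μ₁ : Measure (InfiniteAdeleRing ↥(maximalRealSubfield L))) [μ₁.IsAddHaarMeasure] (μ₂ : Measure (FiniteAdeleRing (𝓞 ↥(maximalRealSubfield L)) ↥(maximalRealSubfield L))) [μ₂.IsAddHaarMeasure]
    (χ : HeckeCharacter L) (hχ : χ.IsUnitary) {z : ℂ} (hz : 1 < z.re)
    {φ : (quasiSplit (↥(maximalRealSubfield L)) L (IsCMField.complexConj L) 2).Adelic → ℂ} (hφc : Continuous φ) {Mφ : ℝ} (hφM : ∀ x, ‖φ x‖ ≤ Mφ)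
    (hφB : ∀ b ∈ borelU ((IsCMField.complexConj L : L ≃ₐ[↥(maximalRealSubfield L)] L) : L →+* L) ((StdForm.antidiagonal 2).over L), ∀ x : (quasiSplit (↥(maximalRealSubfield L)) L (IsCMField.complexConj L) 2).Adelic, φ ((quasiSplit (↥(maximalRealSubfield L)) L (IsCMField.complexConj L) 2).toAdelic b * x) = φ x)
    (hf : ∀ (b g : (quasiSplit (↥(maximalRealSubfield L)) L (IsCMField.complexConj L) 2).Adelic) (u : (AdeleRing (𝓞 L) L)ˣ),
      ((b.1 : GL (Fin 2) (AdeleRing (𝓞 L) L)) : Matrix (Fin 2) (Fin 2) (AdeleRing (𝓞 L) L)) 1 0 = 0 →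
      (u : (AdeleRing (𝓞 L) L)) = ((b.1 : GL (Fin 2) (AdeleRing (𝓞 L) L)) : Matrix (Fin 2) (Fin 2) (AdeleRing (𝓞 L) L)) 0 0 →
        flatSectionU φ z (b * g) = ((χ u : ℂˣ) : ℂ) * ((ideleNorm u : ℝ) : ℂ) ^ z * flatSectionU φ z g)
    {U₀ : Subgroup (GL (Fin 2) (FiniteAdeleRing (𝓞 L) L))} (hU₀o : IsOpen (U₀ : Set (GL (Fin 2) (FiniteAdeleRing (𝓞 L) L))))
    (hU₀K : U₀ ≤ glFiniteIntegralLevel 2 L)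
    (hφU : ∀ u : (quasiSplit (↥(maximalRealSubfield L)) L (IsCMField.complexConj L) 2).Adelic, adelicVal ↥(maximalRealSubfield L) L (IsCMField.complexConj L) 2 ((StdForm.antidiagonal 2).over L) u ∈ U₀.map (GLn.ofFinite 2 L) → ∀ y : (quasiSplit (↥(maximalRealSubfield L)) L (IsCMField.complexConj L) 2).Adelic, φ (y * u) = φ y)
    {T : ℝ≥0} (hT : 1 ≤ T) {m : ℕ} (hm : (finrank ℚ ↥(maximalRealSubfield L) : ℝ) < m) {Cφ : ℝ} (hCφ : 0 ≤ Cφ)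
    (hφarch : ∀ k ∈ ((standardMaximalCompactGL 2 L).comap (adelicVal ↥(maximalRealSubfield L) L (IsCMField.complexConj L) 2 ((StdForm.antidiagonal 2).over L)) : Subgroup (quasiSplit (↥(maximalRealSubfield L)) L (IsCMField.complexConj L) 2).Adelic), ∀ b : FiniteAdeleRing (𝓞 ↥(maximalRealSubfield L)) ↥(maximalRealSubfield L),
      ContDiff ℝ m ((fun a : InfiniteAdeleRing ↥(maximalRealSubfield L) => flatSectionU φ z (((quasiSplit (↥(maximalRealSubfield L)) L (IsCMField.complexConj L) 2).toAdelic (weylLongU ((IsCMField.complexConj L : L ≃ₐ[↥(maximalRealSubfield L)] L) : L →+* L) (rfl : ((StdForm.antidiagonal 2).over L) = ((StdForm.antidiagonal 2).over L)))) *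
          ((middleRootUnipotent hij hN (Multiplicative.ofAdd (traceZeroLine ↥(maximalRealSubfield L) L (IsCMField.complexConj L) hcδ hδ ((a, b) : AdeleRing (𝓞 ↥(maximalRealSubfield L)) ↥(maximalRealSubfield L)))) : ↥(adelicUnipotent ↥(maximalRealSubfield L) L (IsCMField.complexConj L) 2)) : (quasiSplit (↥(maximalRealSubfield L)) L (IsCMField.complexConj L) 2).Adelic) * k)) ∘ (InfiniteAdeleRing.ringEquiv_mixedSpace ↥(maximalRealSubfield L)).symm) ∧
      ∀ j : ℕ, j ≤ m → ∀ s : mixedSpace ↥(maximalRealSubfield L),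
        ‖iteratedFDeriv ℝ j ((fun a : InfiniteAdeleRing ↥(maximalRealSubfield L) => flatSectionU φ z (((quasiSplit (↥(maximalRealSubfield L)) L (IsCMField.complexConj L) 2).toAdelic (weylLongU ((IsCMField.complexConj L : L ≃ₐ[↥(maximalRealSubfield L)] L) : L →+* L) (rfl : ((StdForm.antidiagonal 2).over L) = ((StdForm.antidiagonal 2).over L)))) *
          ((middleRootUnipotent hij hN (Multiplicative.ofAdd (traceZeroLine ↥(maximalRealSubfield L) L (IsCMField.complexConj L) hcδ hδ ((a, b) : AdeleRing (𝓞 ↥(maximalRealSubfield L)) ↥(maximalRealSubfield L)))) : ↥(adelicUnipotent ↥(maximalRealSubfield L) L (IsCMField.complexConj L) 2)) : (quasiSplit (↥(maximalRealSubfield L)) L (IsCMField.complexConj L) 2).Adelic) * k)) ∘ (InfiniteAdeleRing.ringEquiv_mixedSpace ↥(maximalRealSubfield L)).symm) s‖ ≤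
          Cφ * (borelHeight (((quasiSplit (↥(maximalRealSubfield L)) L (IsCMField.complexConj L) 2).toAdelic (weylLongU ((IsCMField.complexConj L : L ≃ₐ[↥(maximalRealSubfield L)] L) : L →+* L) (rfl : ((StdForm.antidiagonal 2).over L) = ((StdForm.antidiagonal 2).over L)))) *
          ((middleRootUnipotent hij hN (Multiplicative.ofAdd (traceZeroLine ↥(maximalRealSubfield L) L (IsCMField.complexConj L) hcδ hδ (((InfiniteAdeleRing.ringEquiv_mixedSpace ↥(maximalRealSubfield L)).symm s, b) : AdeleRing (𝓞 ↥(maximalRealSubfield L)) ↥(maximalRealSubfield L)))) : ↥(adelicUnipotent ↥(maximalRealSubfield L) L (IsCMField.complexConj L) 2)) : (quasiSplit (↥(maximalRealSubfield L)) L (IsCMField.complexConj L) 2).Adelic) * k) : ℝ) ^ z.re) :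
    ∃ M₁ : ℝ, ∀ g : (quasiSplit (↥(maximalRealSubfield L)) L (IsCMField.complexConj L) 2).Adelic, T < borelHeight g →
      ‖eisensteinSeriesU (flatSectionU φ z) g - borelConstantTerm ν 𝓕 (eisensteinSeriesU (flatSectionU φ z)) g‖ ≤ M₁ := by
  haveI : Algebra.IsQuadraticExtension ↥(maximalRealSubfield L) L := IsCMField.isQuadraticExtension L
  have hKc : IsCompact (((standardMaximalCompactGL 2 L).comap (adelicVal ↥(maximalRealSubfield L) L (IsCMField.complexConj L) 2 ((StdForm.antidiagonal 2).over L)) : Subgroup (quasiSplit (↥(maximalRealSubfield L)) L (IsCMField.complexConj L) 2).Adelic) : Set (quasiSplit (↥(maximalRealSubfield L)) L (IsCMField.complexConj L) 2).Adelic) := isCompact_comap_adelicVal_standardMaximalCompactGL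
  have h𝓔U : ∀ u : (quasiSplit (↥(maximalRealSubfield L)) L (IsCMField.complexConj L) 2).Adelic, adelicVal ↥(maximalRealSubfield L) L (IsCMField.complexConj L) 2 ((StdForm.antidiagonal 2).over L) u ∈ U₀.map (GLn.ofFinite 2 L) → ∀ y : (quasiSplit (↥(maximalRealSubfield L)) L (IsCMField.complexConj L) 2).Adelic,
      (fun y : (quasiSplit (↥(maximalRealSubfield L)) L (IsCMField.complexConj L) 2).Adelic => Cφ * (borelHeight y : ℝ) ^ z.re) (y * u) = (fun y : (quasiSplit (↥(maximalRealSubfield L)) L (IsCMField.complexConj L) 2).Adelic => Cφ * (borelHeight y : ℝ) ^ z.re) y := by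
    intro u hu y
    obtain ⟨w, hw, hwu⟩ := Subgroup.mem_map.1 hu
    have hk : u ∈ ((standardMaximalCompactGL 2 L).comap (adelicVal ↥(maximalRealSubfield L) L (IsCMField.complexConj L) 2 ((StdForm.antidiagonal 2).over L)) : Subgroup (quasiSplit (↥(maximalRealSubfield L)) L (IsCMField.complexConj L) 2).Adelic) :=
      Subgroup.mem_comap.2 (by rw [← hwu]; exact glIntegralLevel_le_standardMaximalCompactGL (GLn.ofFinite_mem_glIntegralLevel (hU₀K hw)))
    simp only [borelHeight_mul_of_mem_comap_standardMaximalCompactGL hk y]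
  obtain ⟨N, hN'⟩ := exists_integrable_envelope_line_cm_two L hij hN hcδ hδ ν h𝓕 h𝓕c μ hz hCφ
  obtain ⟨A, N₂, hN₂, hA, hdecArch⟩ := exists_fibre_majorant_of_archSmooth_of_level (f := flatSectionU φ z)
    (𝓔 := fun y : (quasiSplit (↥(maximalRealSubfield L)) L (IsCMField.complexConj L) 2).Adelic => Cφ * (borelHeight y : ℝ) ^ z.re) (K := (((standardMaximalCompactGL 2 L).comap (adelicVal ↥(maximalRealSubfield L) L (IsCMField.complexConj L) 2 ((StdForm.antidiagonal 2).over L)) : Subgroup (quasiSplit (↥(maximalRealSubfield L)) L (IsCMField.complexConj L) 2).Adelic) : Set (quasiSplit (↥(maximalRealSubfield L)) L (IsCMField.complexConj L) 2).Adelic)) (m := m)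
    hij hN hcδ hδ μ μ₁ μ₂ hKc hU₀o h𝓔U (fun k hk => (hN' k hk).1) (fun k hk => (hN' k hk).2)
    (fun k hk b => ⟨(hφarch k hk b).1, fun j hj s => (hφarch k hk b).2 j hj s⟩)
  exact exists_bound_sub_borelConstantTerm_level_cm_two L hij hN hcδ hδ ν h𝓕 h𝓕c μ μ₁ μ₂ χ hχ hz hφc hφM hφB hf hU₀o hU₀K hφU hT hm hN₂ hA hdecArch


/-- **`Λ^T E(f_z)` IS BOUNDED ON `U(J₂)(𝔸)` OVER A CM FIELD, from the single archimedean smoothness binder `hφarch`** — edition B ∘ ★ p857723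
`exists_norm_truncation_eisensteinSeriesU_flatSectionU_le_cm_two`: `∃ M, ∀ g, ‖Λ^T E(f_z)(g)‖ ≤ M` (FILE 2's `hΛbdd` at `N = 2` with the ONE binder of ruling «R6d-FIBREWISE» (2)).
[cite: MoeglinWaldspurger1995, I.2.13, IV.2] [cite: Garrett2018, §2.10–§2.11] -/
theorem exists_norm_truncation_flatSectionU_le_level_cm_two_of_archSmooth {δ : L} (hcδ : IsCMField.complexConj L δ = -δ) (hδ : δ ≠ 0)
    (ν : Measure ↥(adelicUnipotent ↥(maximalRealSubfield L) L (IsCMField.complexConj L) 2)) [ν.IsHaarMeasure]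
    {𝓕 : Set ↥(adelicUnipotent ↥(maximalRealSubfield L) L (IsCMField.complexConj L) 2)} (h𝓕 : IsFundamentalDomain ↥(rationalUnipotent ↥(maximalRealSubfield L) L (IsCMField.complexConj L) 2) 𝓕 ν)
    (h𝓕c : IsCompact (closure 𝓕))
    (μ : Measure (AdeleRing (𝓞 ↥(maximalRealSubfield L)) ↥(maximalRealSubfield L))) [μ.IsAddHaarMeasure]
    (μ₁ : Measure (InfiniteAdeleRing ↥(maximalRealSubfield L))) [μ₁.IsAddHaarMeasure] (μ₂ : Measure (FiniteAdeleRing (𝓞 ↥(maximalRealSubfield L)) ↥(maximalRealSubfield L))) [μ₂.IsAddHaarMeasure]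
    (χ : HeckeCharacter L) (hχ : χ.IsUnitary) {z : ℂ} (hz : 1 < z.re)
    {φ : (quasiSplit (↥(maximalRealSubfield L)) L (IsCMField.complexConj L) 2).Adelic → ℂ} (hφc : Continuous φ) {Mφ : ℝ} (hφM : ∀ x, ‖φ x‖ ≤ Mφ)
    (hφB : ∀ b ∈ borelU ((IsCMField.complexConj L : L ≃ₐ[↥(maximalRealSubfield L)] L) : L →+* L) ((StdForm.antidiagonal 2).over L), ∀ x : (quasiSplit (↥(maximalRealSubfield L)) L (IsCMField.complexConj L) 2).Adelic, φ ((quasiSplit (↥(maximalRealSubfield L)) L (IsCMField.complexConj L) 2).toAdelic b * x) = φ x)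
    (hf : ∀ (b g : (quasiSplit (↥(maximalRealSubfield L)) L (IsCMField.complexConj L) 2).Adelic) (u : (AdeleRing (𝓞 L) L)ˣ),
      ((b.1 : GL (Fin 2) (AdeleRing (𝓞 L) L)) : Matrix (Fin 2) (Fin 2) (AdeleRing (𝓞 L) L)) 1 0 = 0 →
      (u : (AdeleRing (𝓞 L) L)) = ((b.1 : GL (Fin 2) (AdeleRing (𝓞 L) L)) : Matrix (Fin 2) (Fin 2) (AdeleRing (𝓞 L) L)) 0 0 →
        flatSectionU φ z (b * g) = ((χ u : ℂˣ) : ℂ) * ((ideleNorm u : ℝ) : ℂ) ^ z * flatSectionU φ z g)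
    {U₀ : Subgroup (GL (Fin 2) (FiniteAdeleRing (𝓞 L) L))} (hU₀o : IsOpen (U₀ : Set (GL (Fin 2) (FiniteAdeleRing (𝓞 L) L))))
    (hU₀K : U₀ ≤ glFiniteIntegralLevel 2 L)
    (hφU : ∀ u : (quasiSplit (↥(maximalRealSubfield L)) L (IsCMField.complexConj L) 2).Adelic, adelicVal ↥(maximalRealSubfield L) L (IsCMField.complexConj L) 2 ((StdForm.antidiagonal 2).over L) u ∈ U₀.map (GLn.ofFinite 2 L) → ∀ y : (quasiSplit (↥(maximalRealSubfield L)) L (IsCMField.complexConj L) 2).Adelic, φ (y * u) = φ y)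
    {T : ℝ≥0} (hT : 1 ≤ T) {m : ℕ} (hm : (finrank ℚ ↥(maximalRealSubfield L) : ℝ) < m) {Cφ : ℝ} (hCφ : 0 ≤ Cφ)
    (hφarch : ∀ k ∈ ((standardMaximalCompactGL 2 L).comap (adelicVal ↥(maximalRealSubfield L) L (IsCMField.complexConj L) 2 ((StdForm.antidiagonal 2).over L)) : Subgroup (quasiSplit (↥(maximalRealSubfield L)) L (IsCMField.complexConj L) 2).Adelic), ∀ b : FiniteAdeleRing (𝓞 ↥(maximalRealSubfield L)) ↥(maximalRealSubfield L),
      ContDiff ℝ m ((fun a : InfiniteAdeleRing ↥(maximalRealSubfield L) => flatSectionU φ z (((quasiSplit (↥(maximalRealSubfield L)) L (IsCMField.complexConj L) 2).toAdelic (weylLongU ((IsCMField.complexConj L : L ≃ₐ[↥(maximalRealSubfield L)] L) : L →+* L) (rfl : ((StdForm.antidiagonal 2).over L) = ((StdForm.antidiagonal 2).over L)))) *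
          ((middleRootUnipotent hij hN (Multiplicative.ofAdd (traceZeroLine ↥(maximalRealSubfield L) L (IsCMField.complexConj L) hcδ hδ ((a, b) : AdeleRing (𝓞 ↥(maximalRealSubfield L)) ↥(maximalRealSubfield L)))) : ↥(adelicUnipotent ↥(maximalRealSubfield L) L (IsCMField.complexConj L) 2)) : (quasiSplit (↥(maximalRealSubfield L)) L (IsCMField.complexConj L) 2).Adelic) * k)) ∘ (InfiniteAdeleRing.ringEquiv_mixedSpace ↥(maximalRealSubfield L)).symm) ∧
      ∀ j : ℕ, j ≤ m → ∀ s : mixedSpace ↥(maximalRealSubfield L),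
        ‖iteratedFDeriv ℝ j ((fun a : InfiniteAdeleRing ↥(maximalRealSubfield L) => flatSectionU φ z (((quasiSplit (↥(maximalRealSubfield L)) L (IsCMField.complexConj L) 2).toAdelic (weylLongU ((IsCMField.complexConj L : L ≃ₐ[↥(maximalRealSubfield L)] L) : L →+* L) (rfl : ((StdForm.antidiagonal 2).over L) = ((StdForm.antidiagonal 2).over L)))) *
          ((middleRootUnipotent hij hN (Multiplicative.ofAdd (traceZeroLine ↥(maximalRealSubfield L) L (IsCMField.complexConj L) hcδ hδ ((a, b) : AdeleRing (𝓞 ↥(maximalRealSubfield L)) ↥(maximalRealSubfield L)))) : ↥(adelicUnipotent ↥(maximalRealSubfield L) L (IsCMField.complexConj L) 2)) : (quasiSplit (↥(maximalRealSubfield L)) L (IsCMField.complexConj L) 2).Adelic) * k)) ∘ (InfiniteAdeleRing.ringEquiv_mixedSpace ↥(maximalRealSubfield L)).symm) s‖ ≤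
          Cφ * (borelHeight (((quasiSplit (↥(maximalRealSubfield L)) L (IsCMField.complexConj L) 2).toAdelic (weylLongU ((IsCMField.complexConj L : L ≃ₐ[↥(maximalRealSubfield L)] L) : L →+* L) (rfl : ((StdForm.antidiagonal 2).over L) = ((StdForm.antidiagonal 2).over L)))) *
          ((middleRootUnipotent hij hN (Multiplicative.ofAdd (traceZeroLine ↥(maximalRealSubfield L) L (IsCMField.complexConj L) hcδ hδ (((InfiniteAdeleRing.ringEquiv_mixedSpace ↥(maximalRealSubfield L)).symm s, b) : AdeleRing (𝓞 ↥(maximalRealSubfield L)) ↥(maximalRealSubfield L)))) : ↥(adelicUnipotent ↥(maximalRealSubfield L) L (IsCMField.complexConj L) 2)) : (quasiSplit (↥(maximalRealSubfield L)) L (IsCMField.complexConj L) 2).Adelic) * k) : ℝ) ^ z.re) :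
    ∃ M : ℝ, ∀ g : (quasiSplit (↥(maximalRealSubfield L)) L (IsCMField.complexConj L) 2).Adelic, ‖truncation ν 𝓕 T (eisensteinSeriesU (flatSectionU φ z)) g‖ ≤ M := by
  obtain ⟨M₁, hdec⟩ := exists_bound_sub_borelConstantTerm_level_cm_two_of_archSmooth L hij hN hcδ hδ ν h𝓕 h𝓕c μ μ₁ μ₂ χ hχ hz hφc
    hφM hφB hf hU₀o hU₀K hφU hT hm hCφ hφarch
  obtain ⟨M₀, h⟩ := exists_norm_truncation_eisensteinSeriesU_flatSectionU_le_cm_two L ν h𝓕 hT hz hφc hφM hφB hdec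
  exact ⟨max M₀ M₁, h⟩


/-! ## (ED. 2) SAT-WITNESS (ruling «VAC-U» (3), dealer K2E1-plan (g4) 2026-09-04T06:20:38Z ∕ 06:21:07Z) -/

omit [MeasurableSpace (quasiSplit (↥(maximalRealSubfield L)) L (IsCMField.complexConj L) 2).Adelic] [BorelSpace (quasiSplit (↥(maximalRealSubfield L)) L (IsCMField.complexConj L) 2).Adelic]
  [MeasurableSpace (AdeleRing (𝓞 L) L)] [BorelSpace (AdeleRing (𝓞 L) L)]
  [MeasurableSpace (AdeleRing (𝓞 ↥(maximalRealSubfield L)) ↥(maximalRealSubfield L))] [BorelSpace (AdeleRing (𝓞 ↥(maximalRealSubfield L)) ↥(maximalRealSubfield L))]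
  [MeasurableSpace (InfiniteAdeleRing ↥(maximalRealSubfield L))] [BorelSpace (InfiniteAdeleRing ↥(maximalRealSubfield L))]
  [MeasurableSpace (FiniteAdeleRing (𝓞 ↥(maximalRealSubfield L)) ↥(maximalRealSubfield L))] [BorelSpace (FiniteAdeleRing (𝓞 ↥(maximalRealSubfield L)) ↥(maximalRealSubfield L))] in
/-- **SAT-WITNESS for the level letter of this file**: the structural binders `(hU₀o : IsOpen ↑U₀) (hU₀K : U₀ ≤ glFiniteIntegralLevel 2 L)` are jointly satisfiable — by
`U₀ := GL₂(𝒪̂_L)` itself (★ `isOpen_glFiniteIntegralLevel`); and with it the invariance binder `hφU` is satisfiable too (e.g. by any right-`{1} × GL₂(𝒪̂_L)`-invariant `φ`, such as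
a constant).  Contrast ★ `K2E1MaximalCompactNoOpenSubgroupU2.not_exists_isOpen_and_le_two` for the superseded open-`U` letter. [cite: BorelJacquet1979, §4.1] -/
theorem exists_level_binders_cm_two :
    ∃ U₀ : Subgroup (GL (Fin 2) (FiniteAdeleRing (𝓞 L) L)),
      IsOpen (U₀ : Set (GL (Fin 2) (FiniteAdeleRing (𝓞 L) L))) ∧ U₀ ≤ glFiniteIntegralLevel 2 L ∧
      ∀ u : (quasiSplit (↥(maximalRealSubfield L)) L (IsCMField.complexConj L) 2).Adelic, adelicVal ↥(maximalRealSubfield L) L (IsCMField.complexConj L) 2 ((StdForm.antidiagonal 2).over L) u ∈ U₀.map (GLn.ofFinite 2 L) →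
        ∀ y : (quasiSplit (↥(maximalRealSubfield L)) L (IsCMField.complexConj L) 2).Adelic, (fun _ : (quasiSplit (↥(maximalRealSubfield L)) L (IsCMField.complexConj L) 2).Adelic => (1 : ℂ)) (y * u) = (fun _ : (quasiSplit (↥(maximalRealSubfield L)) L (IsCMField.complexConj L) 2).Adelic => (1 : ℂ)) y :=
  ⟨glFiniteIntegralLevel 2 L, isOpen_glFiniteIntegralLevel 2 L, le_rfl, fun _ _ _ => rfl⟩

end Summit.HodgeConjecture.HodgeConjecture.Cruxes.H413.K2E1EisensteinMinusConstantTermBoundedLevelCMTwo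

end
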